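import Summits.QuantumAdvantage.QuantumAdvantage.Theorems.WalkThreeStepFarReadClaim

/-!
# Rung (G♯₂) `ThreeStepFreeRungFive` (item stmt-QuantumAdvantage-23286), architecture (U), the FAR-READ LEMMA 5/6: reduction of the
# far cluster to the far cut and its neighbour (upper side)

Cell qa-qnc0, route OddPrimeWalk, support item stmt-QuantumAdvantage-23286; prover qn-prover-3 g17.

Upper orientation: `h ≥ π + 128` and `h` is EXTREMAL — every cut above `h` reading `π` effectively is constant (`UpMax`; in the
far-read lemma `h` is the topmost far non-constant effective reader of `π`).  By file 4/6 the four-term sum over the cluster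
`G = {q ∈ pairSet : q > z}` vanishes at every input.  §1 generic tools: constant members contribute nothing; the kill of an unread member
from explicit vanishing sums; sums of terms `ζ^{e}(b•1)`.  §2 STEP A: a member at `ρ_π` strictly below `h − 1` (and `≠ ρ_h`) is read by
nobody in `G` (the cut at `π` is not in `G`), so it is killed — contradiction with the line witness (`up_stepA`).  §3 STEP B: a member at
`ρ_h = h − d`, `d ≥ 2`, has label `e_h − d − 1 − m` where `m` counts the ones in `[h−d, h−1)`; choosing one local bit makes the
exponent `≢ 1`, the label-mismatch kill gives `c = 0`, contradicting the line witness (`up_stepB`).  §4 STEP C: hence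
`fourTerm(hq) + fourTerm(h−1) = 0` at every input (`up_pair_eq_zero`).
WHAT THIS IS NOT: the final contradiction (freedom + families) is file 6/6; separation NOT moved.
-/

namespace Summit.QuantumAdvantage.AdviceFreeQNC0.LocalEngine

open Finset Classical

namespace RungU

variable {n : ℕ}

/-! ### §1 Generic tools -/

/-- a constant cut positioned neither at `π` nor at `h` contributes nothing. -/
theorem fourTerm_eq_zero_of_isConst (S : ThreeStep 5 n) (π h : ℕ) (q : Fin (n + 1)) (hqπ : q.val ≠ π) (hqh : q.val ≠ h)
    (hc : IsConst S q) (x : Fin n → Bool) : fourTerm S π h x q = 0 := by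
  rw [fourTerm_eq_c4 S π h x q hqπ hqh]
  have : c4 S π h x q = false := by
    unfold c4 dlt
    rw [hc (cornerFlip n π x) x, hc (cornerFlip n h x) x, hc (cornerFlip n π (cornerFlip n h x)) x]
    cases S.y q x <;> rfl
  rw [this]
  unfold bt
  simp [rotZ_map_zero]

/-- **kill of an unread member from explicit vanishing sums**: if `Σ_T fourTerm` vanishes at every input, a member of `T` positioned
at `k` (away from `π, h`), read by no member of `T` (itself included), has vanishing four-term at every input with `10` at `k`. -/
theorem fourTerm_eq_zero_of_unread' (S : ThreeStep 5 n) {π h k : ℕ} (hkπ : π + 2 ≤ k ∨ k + 2 ≤ π) (hkh : h + 2 ≤ k ∨ k + 2 ≤ h)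
    (hk1 : 1 ≤ k) (hkn : k < n) {T : Finset (Fin (n + 1))} (hT : ∀ y : Fin n → Bool, ∑ q ∈ T, fourTerm S π h y q = 0)
    (q₀ : Fin (n + 1)) (hq₀T : q₀ ∈ T) (hq₀ : q₀.val = k) (hunread : ∀ q ∈ T, cf S q k = 0)
    {x : Fin n → Bool} (hx : Ten x k) : fourTerm S π h x q₀ = 0 := by
  apply kill_member T (fourTerm S π h x) (fourTerm S π h (cornerFlip n k x)) q₀ hq₀T 2 (by decide) (hT x) (hT _)
  · intro q hq hne
    have hqk : q.val ≠ k := fun e => hne (Fin.ext (e.trans hq₀.symm))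
    exact fourTerm_cornerFlip_of_unread S hkπ hkh x q hqk (hunread q hq)
  · exact fourTerm_cornerFlip_self S hkπ hkh hk1 hkn hx q₀ hq₀ (hunread q₀ hq₀T)

/-- sums of terms of the form `ζ^e (b • 1)` have that form. -/
theorem sum_rotZ_bt {ι : Type*} (T : Finset ι) (f : ι → F4) (e : ZMod 3) (h : ∀ q ∈ T, ∃ b : Bool, f q = rotZ e (bt b)) :
    ∃ b : Bool, ∑ q ∈ T, f q = rotZ e (bt b) := by
  classical
  induction T using Finset.induction_on with
  | empty => exact ⟨false, by unfold bt; simp [rotZ_map_zero]⟩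
  | insert a s ha ih =>
    obtain ⟨b₁, hb₁⟩ := h a (Finset.mem_insert_self a s)
    obtain ⟨b₂, hb₂⟩ := ih fun q hq => h q (Finset.mem_insert_of_mem hq)
    refine ⟨xor b₁ b₂, ?_⟩
    rw [Finset.sum_insert ha, hb₁, hb₂, bt_xor, rotZ_map_add]

/-- `-(N : ZMod 3) ≠ 1` when `N % 3 ≠ 2`. -/
theorem neg_cast_ne_one {N : ℕ} (h : N % 3 ≠ 2) : -((N : ℕ) : ZMod 3) ≠ 1 := by
  rw [← ZMod.natCast_mod N 3]
  have h3 : N % 3 < 3 := Nat.mod_lt N (by norm_num)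
  interval_cases hm : N % 3 <;> first | decide | exact absurd rfl h

/-- `(N : ZMod 3) ≠ 1` when `N % 3 ≠ 1`. -/
theorem cast_ne_one {N : ℕ} (h : N % 3 ≠ 1) : ((N : ℕ) : ZMod 3) ≠ 1 := by
  rw [← ZMod.natCast_mod N 3]
  have h3 : N % 3 < 3 := Nat.mod_lt N (by norm_num)
  interval_cases hm : N % 3 <;> first | decide | exact absurd rfl h

namespace Scene

variable (sc : Scene n)

/-- the reads of a member of `pairSet` other than the cut at `π` lie in `{π, h, ρ_h}`. -/
theorem read_of_mem_ne_πq {q : Fin (n + 1)} (hq : q ∈ pairSet sc.S sc.π sc.h) (hne : q.val ≠ sc.π) {r : ℕ}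
    (hr : cf sc.S q r ≠ 0) : r = sc.π ∨ r = sc.h ∨ r = sc.ρh := by
  rw [mem_pairSet] at hq
  obtain ⟨h1, h2⟩ := hq
  have hπh : sc.π ≠ sc.h := by have := sc.far; omega
  rcases h1 with h1 | h1
  · exact absurd h1 hne
  · rcases h2 with h2 | h2
    · have hqh : q = sc.hq := sc.eq_hq_of_val h2
      subst hqh
      rcases read_eq_of_cf sc.S sc.hq h1 hr with e | e
      · exact Or.inl e
      · exact Or.inr (Or.inr e)
    · rcases read_eq_of_cf sc.S q h1 hr with e | e
      · exact Or.inl e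
      · rcases read_eq_of_cf sc.S q h1 h2 with e' | e'
        · exact absurd e'.symm hπh
        · exact Or.inr (Or.inl (e.trans e'.symm))

/-- a member not positioned at `π` or `h` reads both effectively. -/
theorem cf_ne_zero_of_mem {q : Fin (n + 1)} (hq : q ∈ pairSet sc.S sc.π sc.h) (h1 : q.val ≠ sc.π) (h2 : q.val ≠ sc.h) :
    cf sc.S q sc.π ≠ 0 ∧ cf sc.S q sc.h ≠ 0 := by
  rw [mem_pairSet] at hq
  obtain ⟨a1, a2⟩ := hq
  exact ⟨a1.resolve_left h1, a2.resolve_left h2⟩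

/-! ### §2 Upper orientation, step A: no member at `ρ_π` below `h − 1` -/

/-- extremality on the upper side: cuts above `h` reading `π` effectively are constant. -/
def UpMax : Prop := ∀ q : Fin (n + 1), sc.h < q.val → cf sc.S q sc.π ≠ 0 → IsConst sc.S q

/-- members above `h` contribute nothing (upper extremality). -/
theorem fourTerm_eq_zero_of_above (hup : sc.π + 128 ≤ sc.h) (hmax : sc.UpMax) {q : Fin (n + 1)}
    (hq : q ∈ pairSet sc.S sc.π sc.h) (habove : sc.h < q.val) (x : Fin n → Bool) : fourTerm sc.S sc.π sc.h x q = 0 := by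
  have hqπ : q.val ≠ sc.π := by omega
  have hqh : q.val ≠ sc.h := by omega
  exact fourTerm_eq_zero_of_isConst sc.S sc.π sc.h q hqπ hqh (hmax q habove (sc.cf_ne_zero_of_mem hq hqπ hqh).1) x

/-- **STEP A (upper side)**: with the cluster sum over `G = {q ∈ pairSet : q > z}` vanishing identically (`z ≥ π + 2`, the zone above `z`
avoiding `ρ_π`), no member of `G` sits strictly below `h − 1` away from `ρ_h`. -/
theorem up_stepA (hup : sc.π + 128 ≤ sc.h) {z : ℕ} (hz : sc.π + 2 ≤ z ∧ z ≤ sc.π + 22) (hzπ : ¬ (z < sc.ρπ ∧ sc.ρπ < z + 9))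
    (hG : ∀ x : Fin n → Bool, ∑ q ∈ (pairSet sc.S sc.π sc.h).filter (fun q => ¬ q.val ≤ z), fourTerm sc.S sc.π sc.h x q = 0)
    {q : Fin (n + 1)} (hqG : q ∈ (pairSet sc.S sc.π sc.h).filter (fun q => ¬ q.val ≤ z)) (hlow : q.val + 1 < sc.h)
    (hρ : q.val ≠ sc.ρh) : False := by
  rw [Finset.mem_filter] at hqG
  obtain ⟨hq, hqz⟩ := hqG
  have hr := sc.room
  have hh := sc.h_bounds
  -- position of q: it is ρπ, at least z + 9
  have hpos : q.val = sc.ρπ := by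
    rcases sc.pos_of_mem_pairSet hq with e | e | e | e | e | e | e | e <;> omega
  have hk : z + 9 ≤ q.val := by omega
  have hqπ : q.val ≠ sc.π := by omega
  have hqh : q.val ≠ sc.h := by omega
  obtain ⟨cπ, ch⟩ := sc.cf_ne_zero_of_mem hq hqπ hqh
  have hb := sc.pos_of_cf q cπ
  -- the kill: nobody in G reads q
  have hkill : ∀ x : Fin n → Bool, Ten x q.val → c4 sc.S sc.π sc.h x q = false := by
    intro x hx
    have h0 := fourTerm_eq_zero_of_unread' sc.S (k := q.val) (by omega) (by omega) (by omega) (by omega) hG q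
      (Finset.mem_filter.mpr ⟨hq, hqz⟩) rfl
      (fun q' hq' => by
        rw [Finset.mem_filter] at hq'
        have hne : q'.val ≠ sc.π := by omega
        by_contra hc
        rcases sc.read_of_mem_ne_πq hq'.1 hne hc with e | e | e <;> omega) hx
    rw [fourTerm_eq_c4 sc.S sc.π sc.h x q hqπ hqh] at h0
    exact (bt_eq_zero _).mp (eq_zero_of_rotZ _ _ h0)
  -- the line witness
  set P₀ : Finset ℕ := {sc.π - 1, sc.h - 1, q.val - 1} with hP₀
  have memP₀ : ∀ j, j ∈ P₀ ↔ (j = sc.π - 1 ∨ j = sc.h - 1 ∨ j = q.val - 1) := by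
    intro j; simp only [hP₀, Finset.mem_insert, Finset.mem_singleton]
  obtain ⟨β, hβ, j, hj, hc⟩ := line_witness sc.S sc.πh2 (by omega) (by omega) (by omega) (by omega) q cπ ch P₀
    (fun j hj => by rw [memP₀] at hj; omega)
    ⟨(memP₀ _).mpr (Or.inl rfl), fun hm => by rw [memP₀] at hm; omega⟩
    ⟨(memP₀ _).mpr (Or.inr (Or.inl rfl)), fun hm => by rw [memP₀] at hm; omega⟩
    0 (sc.π + 1) (sc.h + 1) ⟨by omega, by omega⟩ (Or.inl ⟨by omega, by omega⟩) ⟨by omega, by omega, by omega⟩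
    (fun i hi => by rw [memP₀] at hi; refine ⟨by omega, by omega, by omega⟩)
  have hten : Ten (indic (P₀ ∪ Ico β (β + j)) : Fin n → Bool) q.val := by
    apply ten_indic _ (by omega)
    · exact Finset.mem_union_left _ ((memP₀ _).mpr (Or.inr (Or.inr rfl)))
    · rw [Finset.mem_union, memP₀, Finset.mem_Ico, not_or]
      refine ⟨by omega, ?_⟩
      rcases hβ with rfl | rfl | rfl <;> omega
  rw [hkill _ hten] at hc
  exact Bool.false_ne_true hc

/-! ### §3 Upper orientation, step B: no member at `ρ_h` below `h − 1` -/

/-- the far cut does not read its own position unless `ρ_h = h`. -/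
theorem cf_hq_h_eq_zero (hρ : sc.ρh ≠ sc.h) : cf sc.S sc.hq sc.h = 0 := by
  by_contra hc
  have hπh : sc.π ≠ sc.h := by have := sc.far; omega
  rcases read_eq_of_cf sc.S sc.hq sc.reads hc with e | e
  · exact hπh e.symm
  · exact hρ e.symm

/-- the label of the neighbour below: `lab(h−1) = lab(h) + 1` under `10` at `h`. -/
theorem lab_pred (x : Fin n → Bool) (hx : Ten x sc.h) (q : Fin (n + 1)) (hq : q.val = sc.h - 1) : lab x q = lab x sc.hq + 1 := by
  have hh := sc.h_bounds
  unfold lab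
  rw [hq, sc.hq_val]
  have e := Coset21.wtPrefix_succ x (sc.h - 1) (by omega)
  rw [show sc.h - 1 + 1 = sc.h by omega, (hx ⟨sc.h - 1, by omega⟩).1 (by simp; omega)] at e
  simp only [if_true] at e
  rw [e]
  push_cast
  have : ((sc.h : ℕ) : ZMod 3) = (((sc.h - 1 : ℕ) : ℕ) : ZMod 3) + 1 := by
    rw [show sc.h = (sc.h - 1) + 1 from by omega]
    push_cast
    ring_nf
  rw [this]
  have h3 : ∀ a b : ZMod 3, a + b = a + 1 + (b + 1) + 1 := by decide
  exact h3 _ _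

/-- every member of the upper cluster other than a given `ρ`-member contributes `ζ^{e_h+1}(b • 1)` at inputs with `10` at `h`
(`h` itself: `δ`; the neighbour `h−1`: its `c`; members above `h`: `0`; members at `ρ_π` below: impossible by step A). -/
theorem up_member_form (hup : sc.π + 128 ≤ sc.h) (hmax : sc.UpMax) {z : ℕ} (hz : sc.π + 2 ≤ z ∧ z ≤ sc.π + 22)
    (hzπ : ¬ (z < sc.ρπ ∧ sc.ρπ < z + 9))
    (hG : ∀ x : Fin n → Bool, ∑ q ∈ (pairSet sc.S sc.π sc.h).filter (fun q => ¬ q.val ≤ z), fourTerm sc.S sc.π sc.h x q = 0)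
    (hself : sc.ρh ≠ sc.h) {x : Fin n → Bool} (hx : Ten x sc.h)
    {q : Fin (n + 1)} (hqG : q ∈ (pairSet sc.S sc.π sc.h).filter (fun q => ¬ q.val ≤ z)) (hq : q.val ≠ sc.ρh) :
    ∃ b : Bool, fourTerm sc.S sc.π sc.h x q = rotZ (lab x sc.hq + 1) (bt b) := by
  have hqG' := hqG
  rw [Finset.mem_filter] at hqG
  obtain ⟨hqP, hqz⟩ := hqG
  have hh := sc.h_bounds
  by_cases h1 : q.val = sc.h
  · have e : q = sc.hq := sc.eq_hq_of_val h1
    subst e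
    exact ⟨dlt sc.S sc.π x sc.hq, fourTerm_self sc.S sc.πh2 (by omega) (by omega) hx sc.hq sc.hq_val (sc.cf_hq_h_eq_zero hself)⟩
  · by_cases h2 : q.val = sc.h - 1
    · refine ⟨c4 sc.S sc.π sc.h x q, ?_⟩
      rw [fourTerm_eq_c4 sc.S sc.π sc.h x q (by omega) h1, sc.lab_pred x hx q h2]
    · by_cases h3 : sc.h < q.val
      · exact ⟨false, by rw [sc.fourTerm_eq_zero_of_above hup hmax hqP h3]; unfold bt; simp [rotZ_map_zero]⟩
      · exfalso
        exact sc.up_stepA hup hz hzπ hG hqG' (by omega) hq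

/-- **STEP B (upper side)**: no member of the cluster sits at `ρ_h` strictly below `h − 1`. -/
theorem up_stepB (hup : sc.π + 128 ≤ sc.h) (hmax : sc.UpMax) {z : ℕ} (hz : sc.π + 2 ≤ z ∧ z ≤ sc.π + 22)
    (hzρ : ¬ (z < sc.ρh ∧ sc.ρh < z + 9)) (hzπ : ¬ (z < sc.ρπ ∧ sc.ρπ < z + 9))
    (hG : ∀ x : Fin n → Bool, ∑ q ∈ (pairSet sc.S sc.π sc.h).filter (fun q => ¬ q.val ≤ z), fourTerm sc.S sc.π sc.h x q = 0)
    {q : Fin (n + 1)} (hqG : q ∈ (pairSet sc.S sc.π sc.h).filter (fun q => ¬ q.val ≤ z)) (hlow : q.val + 1 < sc.h)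
    (hρ : q.val = sc.ρh) : False := by
  have hqG' := hqG
  rw [Finset.mem_filter] at hqG
  obtain ⟨hq, hqz⟩ := hqG
  have hr := sc.room
  have hh := sc.h_bounds
  have hk : z + 9 ≤ q.val := by omega
  have hqπ : q.val ≠ sc.π := by omega
  have hqh : q.val ≠ sc.h := by omega
  have hself : sc.ρh ≠ sc.h := by omega
  obtain ⟨cπ, ch⟩ := sc.cf_ne_zero_of_mem hq hqπ hqh
  -- the local bit making the label exponent ≢ 1
  set d := sc.h - q.val with hd
  set m₀ := (if (d + 1) % 3 = 2 then 1 else 0) with hm₀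
  have hm₀le : m₀ ≤ 1 := by rw [hm₀]; split_ifs <;> omega
  have hgood : (d + 1 + m₀) % 3 ≠ 2 := by rw [hm₀]; split_ifs with hc <;> omega
  set P₀ : Finset ℕ := ({sc.π - 1, sc.h - 1} : Finset ℕ) ∪ Ico (sc.h - 2) (sc.h - 2 + m₀) with hP₀
  have memP₀ : ∀ j, j ∈ P₀ ↔ (j = sc.π - 1 ∨ j = sc.h - 1 ∨ (sc.h - 2 ≤ j ∧ j < sc.h - 2 + m₀)) := by
    intro j; simp only [hP₀, Finset.mem_union, Finset.mem_insert, Finset.mem_singleton, Finset.mem_Ico, or_assoc]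
  have hP₀n : ∀ j ∈ P₀, j < n := fun j hj => by rw [memP₀] at hj; omega
  -- prefix counts of the base set at h and at ρh
  have base_h : (P₀.filter fun j => j < sc.h).card = 2 + m₀ := by
    have : (P₀.filter fun j => j < sc.h) = P₀ := Finset.filter_true_of_mem fun j hj => by rw [memP₀] at hj; omega
    rw [this, hP₀, Finset.card_union_of_disjoint, Finset.card_pair (by omega), Nat.card_Ico]
    · omega
    · rw [Finset.disjoint_left]; intro j hj1 hj2
      simp only [Finset.mem_insert, Finset.mem_singleton] at hj1
      rw [Finset.mem_Ico] at hj2; omega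
  have base_ρ : (P₀.filter fun j => j < q.val).card = 1 := by
    have : (P₀.filter fun j => j < q.val) = {sc.π - 1} := by
      ext j; rw [Finset.mem_filter, memP₀, Finset.mem_singleton]; omega
    rw [this, Finset.card_singleton]
  -- the kill at every admissible witness input
  have hkill : ∀ β j : ℕ, (β = 0 ∨ β = sc.π + 1 ∨ β = sc.h + 1) → j < 5 →
      c4 sc.S sc.π sc.h (indic (P₀ ∪ Ico β (β + j)) : Fin n → Bool) q = false := by
    intro β j hβ hj
    set P := P₀ ∪ Ico β (β + j) with hP
    have hPn : ∀ i ∈ P, i < n := by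
      intro i hi; rw [hP, Finset.mem_union, Finset.mem_Ico] at hi
      rcases hi with hi | hi
      · exact hP₀n i hi
      · rcases hβ with rfl | rfl | rfl <;> omega
    have hdis : ∀ i ∈ P₀, ¬ (β ≤ i ∧ i < β + j) := by
      intro i hi; rw [memP₀] at hi; rcases hβ with rfl | rfl | rfl <;> omega
    have tenh : Ten (indic P : Fin n → Bool) sc.h := by
      apply ten_indic _ (by omega)
      · rw [hP]; exact Finset.mem_union_left _ ((memP₀ _).mpr (Or.inr (Or.inl rfl)))
      · rw [hP, Finset.mem_union, memP₀, Finset.mem_Ico, not_or]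
        refine ⟨by omega, ?_⟩; rcases hβ with rfl | rfl | rfl <;> omega
    -- the cluster sum, split off the ρ-member
    have hsum := hG (indic P)
    rw [← Finset.add_sum_erase _ _ hqG'] at hsum
    obtain ⟨B, hB⟩ := sum_rotZ_bt (((pairSet sc.S sc.π sc.h).filter fun q => ¬ q.val ≤ z).erase q)
      (fourTerm sc.S sc.π sc.h (indic P)) (lab (indic P : Fin n → Bool) sc.hq + 1)
      (fun q' hq' => sc.up_member_form hup hmax hz hzπ hG hself tenh (Finset.mem_of_mem_erase hq')
        (fun e => Finset.ne_of_mem_erase hq' (Fin.ext (e.trans hρ.symm))))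
    rw [hB, fourTerm_eq_c4 sc.S sc.π sc.h _ q hqπ hqh] at hsum
    -- the two labels
    have hlab : lab (indic P : Fin n → Bool) sc.hq = lab (indic P : Fin n → Bool) q + ((d + 1 + m₀ : ℕ) : ZMod 3) := by
      rw [lab_indic P hPn, lab_indic P hPn, sc.hq_val]
      have e1 : (P.filter fun i => i < sc.h).card = 2 + m₀ + (min (β + j) sc.h - β) := by
        rw [hP, card_lt_union _ _ (Finset.disjoint_left.mpr fun i hi hI => hdis i hi (Finset.mem_Ico.mp hI)), base_h, card_lt_Ico]
      have e2 : (P.filter fun i => i < q.val).card = 1 + (min (β + j) q.val - β) := by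
        rw [hP, card_lt_union _ _ (Finset.disjoint_left.mpr fun i hi hI => hdis i hi (Finset.mem_Ico.mp hI)), base_ρ, card_lt_Ico]
      have e3 : min (β + j) sc.h - β = min (β + j) q.val - β := by
        rcases hβ with rfl | rfl | rfl
        · rw [block_below 0 j sc.h (by omega), block_below 0 j q.val (by omega)]
        · rw [block_below _ j sc.h (by omega), block_below _ j q.val (by omega)]
        · rw [block_above _ j sc.h (by omega), block_above _ j q.val (by omega)]
      rw [e1, e2, e3]
      have : sc.h + (2 + m₀ + (min (β + j) q.val - β)) = q.val + (1 + (min (β + j) q.val - β)) + (d + 1 + m₀) := by omega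
      rw [this]; push_cast; ring
    rw [hlab, show lab (indic P : Fin n → Bool) q + ((d + 1 + m₀ : ℕ) : ZMod 3) + 1
        = lab (indic P : Fin n → Bool) q + (((d + 1 + m₀ : ℕ) : ZMod 3) + 1) by ring, ← rotZ_rotZ, ← rotZ_rotZ,
      ← rotZ_map_add] at hsum
    have h0 := eq_zero_of_rotZ _ _ hsum
    -- c•1 + ζ^{d+1+m₀} (ζ (B•1)) = 0  ⇒ rotate back: ζ (B•1) + ζ^{-(d+1+m₀)} (c•1) = 0
    have h1 : rotZ 1 (bt B) + rotZ (-((d + 1 + m₀ : ℕ) : ZMod 3)) (bt (c4 sc.S sc.π sc.h (indic P) q)) = 0 := by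
      have e : rotZ (-((d + 1 + m₀ : ℕ) : ZMod 3))
          (bt (c4 sc.S sc.π sc.h (indic P) q) + rotZ ((d + 1 + m₀ : ℕ) : ZMod 3) (rotZ 1 (bt B))) = 0 := by
        rw [h0, rotZ_map_zero]
      rw [rotZ_map_add, rotZ_rotZ, neg_add_cancel, rotZ_zero] at e
      rw [add_comm]; exact e
    exact kill_of_ne_one B _ _ (neg_cast_ne_one hgood) h1
  -- the line witness contradicts the kill
  obtain ⟨β, hβ, j, hj, hc⟩ := line_witness sc.S sc.πh2 (by omega) (by omega) (by omega) (by omega) q cπ ch P₀ hP₀n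
    ⟨(memP₀ _).mpr (Or.inl rfl), fun hm => by rw [memP₀] at hm; omega⟩
    ⟨(memP₀ _).mpr (Or.inr (Or.inl rfl)), fun hm => by rw [memP₀] at hm; omega⟩
    0 (sc.π + 1) (sc.h + 1) ⟨by omega, by omega⟩ (Or.inl ⟨by omega, by omega⟩) ⟨by omega, by omega, by omega⟩
    (fun i hi => by rw [memP₀] at hi; refine ⟨by omega, by omega, by omega⟩)
  rw [hkill β j hβ hj] at hc
  exact Bool.false_ne_true hc

/-! ### §4 Upper orientation, step C: the cluster is the far cut and its lower neighbour -/

/-- the lower neighbour of the far cut. -/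
def qdn : Fin (n + 1) := ⟨sc.h - 1, by have := sc.h_bounds; omega⟩

/-- its position. -/
theorem qdn_val : sc.qdn.val = sc.h - 1 := rfl

/-- **STEP C (upper side)**: `fourTerm(hq) + fourTerm(h−1) = 0` at every input. -/
theorem up_pair_eq_zero (hup : sc.π + 128 ≤ sc.h) (hmax : sc.UpMax) (x : Fin n → Bool) :
    fourTerm sc.S sc.π sc.h x sc.hq + fourTerm sc.S sc.π sc.h x sc.qdn = 0 := by
  obtain ⟨z, hz1, hz2, hzρ, hzπ, hG⟩ := sc.far_sum_eq_zero_up hup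
  have hh := sc.h_bounds
  set G := (pairSet sc.S sc.π sc.h).filter (fun q => ¬ q.val ≤ z) with hGdef
  -- every member other than hq, qdn contributes 0
  have hzero : ∀ q ∈ G, q ≠ sc.hq → q ≠ sc.qdn → fourTerm sc.S sc.π sc.h x q = 0 := by
    intro q hqG h1 h2
    have hqG' := hqG
    rw [hGdef, Finset.mem_filter] at hqG
    have hv1 : q.val ≠ sc.h := fun e => h1 (sc.eq_hq_of_val e)
    have hv2 : q.val ≠ sc.h - 1 := fun e => h2 (Fin.ext (by rw [qdn_val]; exact e))
    by_cases habove : sc.h < q.val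
    · exact sc.fourTerm_eq_zero_of_above hup hmax hqG.1 habove x
    · exfalso
      by_cases hρ : q.val = sc.ρh
      · exact sc.up_stepB hup hmax ⟨hz1, hz2⟩ hzρ hzπ hG hqG' (by omega) hρ
      · exact sc.up_stepA hup ⟨hz1, hz2⟩ hzπ hG hqG' (by omega) hρ
  have hsum := hG x
  have hhqG : sc.hq ∈ G := by rw [hGdef, Finset.mem_filter]; exact ⟨sc.hq_mem, by rw [sc.hq_val]; omega⟩
  rw [← Finset.add_sum_erase _ _ hhqG] at hsum
  by_cases hdn : sc.qdn ∈ G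
  · have hdn' : sc.qdn ∈ G.erase sc.hq := by
      rw [Finset.mem_erase]; refine ⟨fun e => ?_, hdn⟩
      have := congrArg Fin.val e; rw [qdn_val, sc.hq_val] at this; omega
    rw [← Finset.add_sum_erase _ _ hdn'] at hsum
    have : ∑ q ∈ (G.erase sc.hq).erase sc.qdn, fourTerm sc.S sc.π sc.h x q = 0 :=
      Finset.sum_eq_zero fun q hq => hzero q (Finset.mem_of_mem_erase (Finset.mem_of_mem_erase hq))
        (Finset.ne_of_mem_erase (Finset.mem_of_mem_erase hq)) (Finset.ne_of_mem_erase hq)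
    rw [this, add_zero] at hsum
    exact hsum
  · have hnot : sc.qdn ∉ pairSet sc.S sc.π sc.h := by
      intro hm; apply hdn; rw [hGdef, Finset.mem_filter]; exact ⟨hm, by rw [qdn_val]; omega⟩
    have : ∑ q ∈ G.erase sc.hq, fourTerm sc.S sc.π sc.h x q = 0 :=
      Finset.sum_eq_zero fun q hq => hzero q (Finset.mem_of_mem_erase hq) (Finset.ne_of_mem_erase hq)
        (fun e => hdn (e ▸ Finset.mem_of_mem_erase hq))
    rw [this, add_zero] at hsum
    rw [hsum, fourTerm_eq_zero_of_not_mem sc.S sc.πh2 x sc.qdn hnot, add_zero]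

end Scene

end RungU

end Summit.QuantumAdvantage.AdviceFreeQNC0.LocalEngine
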